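import Summits.BirchSwinnertonDyer.BirchSwinnertonDyer.Theses.AlignedTransportAtTwo
import Summits.BirchSwinnertonDyer.BirchSwinnertonDyer.Theses.ByReductionTypeAtTwo
import HarnessLib

/-!
# Route `AlignedTransportAtTwo`, crux C3′ `BSDOfMainConjectureRankOneAtTwo` (stmt-BirchSwinnertonDyer-23008) is DOMINATED by
# route `ByReductionTypeAtTwo`'s rank-one residual `RankOneAtTwo` (stmt-BirchSwinnertonDyer-19099): the by-name bridge

HONEST FRAMING (cell `bsd-f1-sign2`, prover seat `bsd-line-att-p3`; BSD is NOT proved by any of this; pure logic, no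
definition, nothing asserted). The route's own kill criterion reads «a proof of `ByReductionTypeAtTwo.RankOneAtTwo`
(stmt-19099) … moots the route»; for the crux C3′ this is literally an implication between two route declarations:
`RankOneAtTwo` = BSD₂ for EVERY non-CM curve of analytic rank `1`, while C3′ asks BSD₂ only for the cell curves
(non-CM, good ordinary at `2`, no rational `2`-torsion abscissa, `Δ ∉ ℚ²`, `r_an = 1`) and only GIVEN the simple zero
`ord_T L₂(f_E, T) = 1` and Mazur's `2`-adic main conjecture. So every closing of 19099 (or of its big-image/odd-local
slice 23715 together with the complement 23716, via the glue 23717) closes C3′ by the theorem below; the converse is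
false as an implication of statements (C3′ carries five extra hypotheses). Recorded so that the ledger's cone sees the
dependency by name. [cite: GrossZagier1986] -/

set_option autoImplicit false
-- the route's Theorems namespace repeats a component by design (summit = sub-problem, D-0017).
set_option linter.dupNamespace false

namespace Summit.BirchSwinnertonDyer.BirchSwinnertonDyer.Theorems.AlignedTransportAtTwoRankOneBridge

open Summit.BirchSwinnertonDyer.BirchSwinnertonDyer.Theses

/-- **C3′ ⟸ `RankOneAtTwo` (stmt-19099).** BSD₂ for all non-CM analytic-rank-one curves implies BSD₂ for the cell curves
of route `AlignedTransportAtTwo` under any further hypotheses (the simple-zero and main-conjecture binders of C3′ are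
simply dropped). [cite: GrossZagier1986] -/
theorem bsdOfMainConjectureRankOneAtTwo_of_rankOneAtTwo (h : ByReductionTypeAtTwo.RankOneAtTwo) :
    AlignedTransportAtTwo.BSDOfMainConjectureRankOneAtTwo :=
  fun W _ _ hcm _ _ _ hr _ _ => h W hcm hr

/-- **C3′ ⟸ the two W-42 (β) children of `RankOneAtTwo`** (stmt-23715 big-image/odd-local slice and stmt-23716 its
complement): by cases on the slice conjunction, then the bridge above. [cite: GrossZagier1986] -/
theorem bsdOfMainConjectureRankOneAtTwo_of_slices (hβ : ByReductionTypeAtTwo.RankOneAtTwoBigImageOddLocal)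
    (hβ' : ByReductionTypeAtTwo.RankOneAtTwoOffBigImageOddLocal) :
    AlignedTransportAtTwo.BSDOfMainConjectureRankOneAtTwo := by
  refine bsdOfMainConjectureRankOneAtTwo_of_rankOneAtTwo fun W _ _ hcm hr => ?_
  by_cases hs : (∀ n : ℕ, W.HasSurjectiveModNGaloisRep ((2 ^ n : ℕ) : ℤ)) ∧ Odd W.torsionOrder ∧
      Odd W.tamagawaProduct
  · exact hβ W hcm hs.1 hs.2.1 hs.2.2 hr
  · exact hβ' W hcm hs hr

end Summit.BirchSwinnertonDyer.BirchSwinnertonDyer.Theorems.AlignedTransportAtTwoRankOneBridge
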